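import Summits.CriticalPhenomena.PercolationContinuityZ3.Theorems.PercNearOneGluingNoHeavyLowerTailSahiSlotPairConeThresholdSandwich

/-!
# THE THRESHOLD-MIDDLE LIFT: `PinnedGood (n+1) E → Θ ⊆ E → PinnedGood (n+2) (Θ × {1} ∪ E × {2})`, `Θ = {x : x_last ≥ 1}` —
# a universal pivotal-pair certificate for the mixed chain `(∅, Θ, E)` with an ARBITRARY top `E ⊇ Θ`, in every dimension

Support file of the one-cut programme (crux `NoHeavyLowerTail`, stmt-CriticalPhenomena-4575; cell `prim-masterthm`, seat P3, gen 24;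
`run/shared/lean/prim/prim-masterthm/prim-masterthm-p3/HIERARCHY.md` §32(b'), memo `FROM-prim-masterthm-p3-g24-CERTIFICATE-RULES.md` §0bis).

CONTEXT.  The companion file `…PairConeThresholdSandwich` proves the mixed chain `(∅, X, Θ)` (threshold on TOP, any up-set `X ⊆ Θ` in the
middle).  Gen 24's census over all middles `X ⊆ [3]^2` showed that the ONLY middles for which `(∅, X, E)` has a typed universal certificate for every
top `E ⊇ X` are again the co-bottom thresholds `Θ_a`.  THIS FILE proves that family for the last base axis, in every dimension; along the base's last
axis these sets read `(liftTop E₀, Θ', Θ')` — the first universal family with a NON-EMPTY generic BOTTOM slice (`E = E₀ × {0} ∪ [3]^n × {1,2}`).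
* two more sign-trivial term kinds `inPairCone_VbP`, `inPairCone_VcP` (opposite vertical increment × point);
* `thrMid E := liftTwo (Thr n) ∪ liftTop E = Θ × {1} ∪ E × {2}` (slices `(∅, Θ, E)` when `Θ ⊆ E`);
* **`sStarD_thrMid_eq`** (all finsets `E ⊇ Θ`, `B`, `C`): `6·sStarD (thrMid E) B C = 12·sStarD E B₂ C₂ + 9·sStarD Θ B₁ C₁ + remMid E B C` with
  `remMid` = 18 explicit integer-weighted terms (fibre-Kleitman of `Θ` and `E`, horizontal Harris aggregates on `E ∖ Θ` and on `[3]^{n+1} ∖ E`,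
  Kleitman diagonals of `Θ` at levels 0 and 1, point/increment products), each in `C ⊗ C` (`remMid_inPairCone`); hence, with gen 23's
  `pinnedGood_threshold_one` for `Θ` itself, **`PinnedGood.thrMid : PinnedGood (n+1) E → Θ ⊆ E → PinnedGood (n+2) (thrMid E)`** and the
  value-level corollary `sStarD_thrMid_nonneg`.
Found by the same instance-based LP (joint n' = 2, 3; verified exactly at n' = 4, formal in the free bottom slice of `E`), proved by the same
two-level expansion + `univ` relations + `ring` as the threshold-top sandwich.  The rewrite lists of the two
large normalisations were generated uniformly and then pruned to the lemmas actually used.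
HONEST LABEL: a certificate-format lift theorem in every dimension; no open cell changes status.  Pure, standard axioms. [this work]
-/

noncomputable section

namespace Summit.CriticalPhenomena.PercolationContinuityZ3.Theorems

open Finset Function
open Literature.Combinatorics.Sahi2008

namespace SahiSlot

open SahiGridPattern SahiGrid3

variable {n : ℕ}

/-- Opposite vertical increment × point, the `B`-increment at the free end: `Σ_{p δ̸ q} (1_B(p,k) − 1_B(p,j))·w(q)·1_C(q,m)`. [this work] -/
theorem inPairCone_VbP (W : Finset (Pd n)) {j k : Fin 3} (hjk : j ≤ k) (m : Fin 3) :
    InPairCone (n + 1) (fun B C => ((Nf (ind (sl B k) - ind (sl B j)) (ind W) (ind (sl C m)) : ℤ) : ℝ)) := by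
  have hw : ∀ x ∈ (univ : Finset (Pd n × Pd n)), (0:ℝ) ≤ (ind W x.2 : ℝ) * (if TotDist x.1 x.2 = true then (1:ℝ) else 0) :=
    fun x _ => mul_nonneg (by exact_mod_cast ind_nonneg' W x.2) (by split_ifs <;> norm_num)
  refine (InPairCone.sum_smul univ hw fun x _ => InPairCone.mul (InCone.vincr x.1 hjk) (InCone.point (Fin.snoc x.2 m : Pd (n + 1)))).congr
    fun B C _ _ => ?_
  unfold Nf
  push_cast
  rw [← Finset.univ_product_univ, Finset.sum_product]
  refine Finset.sum_congr rfl fun p _ => Finset.sum_congr rfl fun q _ => ?_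
  simp only [Pi.sub_apply, Int.cast_sub, cast_ind_sl]
  ring

/-- Opposite vertical increment × point, the `C`-increment at the free end: `Σ_{p δ̸ q} (1_C(p,k) − 1_C(p,j))·w(q)·1_B(q,m)`. [this work] -/
theorem inPairCone_VcP (W : Finset (Pd n)) {j k : Fin 3} (hjk : j ≤ k) (m : Fin 3) :
    InPairCone (n + 1) (fun B C => ((Nf (ind (sl C k) - ind (sl C j)) (ind W) (ind (sl B m)) : ℤ) : ℝ)) := by
  have hw : ∀ x ∈ (univ : Finset (Pd n × Pd n)), (0:ℝ) ≤ (ind W x.2 : ℝ) * (if TotDist x.1 x.2 = true then (1:ℝ) else 0) :=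
    fun x _ => mul_nonneg (by exact_mod_cast ind_nonneg' W x.2) (by split_ifs <;> norm_num)
  refine (InPairCone.sum_smul univ hw fun x _ => InPairCone.mul (InCone.point (Fin.snoc x.2 m : Pd (n + 1))) (InCone.vincr x.1 hjk)).congr
    fun B C _ _ => ?_
  unfold Nf
  push_cast
  rw [← Finset.univ_product_univ, Finset.sum_product]
  refine Finset.sum_congr rfl fun p _ => Finset.sum_congr rfl fun q _ => ?_
  simp only [Pi.sub_apply, Int.cast_sub, cast_ind_sl]
  ring

/-! ## THE THRESHOLD-MIDDLE LIFT `E ↦ Θ × {1} ∪ E × {2}` for up-sets `E ⊇ Θ` -/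

/-- **The threshold-middle set** `thrMid E = Θ × {1} ∪ E × {2} ⊆ [3]^{n+2}` (for `Θ ⊆ E`; slices `(∅, Θ, E)`). [this work] -/
def thrMid (E : Finset (Pd (n + 1))) : Finset (Pd (n + 2)) := liftTwo (Thr n) ∪ liftTop E

/-- Bottom slice of the threshold-middle set is empty. [this work] -/
theorem sl_thrMid_zero (E : Finset (Pd (n + 1))) : sl (thrMid E) 0 = ∅ := by
  ext p; simp [thrMid, sl, snoc_mem_liftTwo, snoc_mem_liftTop]
/-- Middle slice of the threshold-middle set is `Θ`. [this work] -/
theorem sl_thrMid_one (E : Finset (Pd (n + 1))) : sl (thrMid E) 1 = Thr n := by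
  ext p; simp [thrMid, sl, snoc_mem_liftTwo, snoc_mem_liftTop]
/-- Top slice of the threshold-middle set is `E` (for `Θ ⊆ E`). [this work] -/
theorem sl_thrMid_two {E : Finset (Pd (n + 1))} (hTE : Thr n ⊆ E) : sl (thrMid E) 2 = E := by
  have h : sl (thrMid E) 2 = Thr n ∪ E := by ext p; simp [thrMid, sl, snoc_mem_liftTwo, snoc_mem_liftTop]
  rw [h]; exact Finset.union_eq_right.2 hTE
/-- The threshold-middle set of an up-set is an up-set. [this work] -/
theorem isUpperSet_thrMid {E : Finset (Pd (n + 1))} (hE : IsUpperSet (E : Set (Pd (n + 1)))) :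
    IsUpperSet ((thrMid E : Finset (Pd (n + 2))) : Set (Pd (n + 2))) := by
  unfold thrMid; rw [Finset.coe_union]
  exact (isUpperSet_liftTwo (isUpperSet_Thr n)).union (isUpperSet_liftTop hE)
/-- A finset containing `Θ` has full middle slice. [this work] -/
theorem sl_one_of_Thr_subset {E : Finset (Pd (n + 1))} (hTE : Thr n ⊆ E) : sl E 1 = univ := by
  ext p
  simp only [sl, Finset.mem_filter, Finset.mem_univ, true_and, iff_true]
  exact hTE (by rw [Thr, snoc_mem_liftTwo]; exact ⟨Finset.mem_univ _, by decide⟩)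
/-- A finset containing `Θ` has full top slice. [this work] -/
theorem sl_two_of_Thr_subset {E : Finset (Pd (n + 1))} (hTE : Thr n ⊆ E) : sl E 2 = univ := by
  ext p
  simp only [sl, Finset.mem_filter, Finset.mem_univ, true_and, iff_true]
  exact hTE (by rw [Thr, snoc_mem_liftTwo]; exact ⟨Finset.mem_univ _, by decide⟩)

/-- The explicit remainder of the threshold-middle lift (18 terms, integer weights). [this work] -/
def remMid (E : Finset (Pd (n + 1))) (B C : Finset (Pd (n + 2))) : ℤ :=
  6 * Nf ((ind (sl C 2)) - (ind (sl C 1))) (ind (E \ Thr n)) (ind (sl B 2))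
  + 6 * Nf ((ind (sl B 2)) - (ind (sl B 1))) (ind (E \ Thr n)) (ind (sl C 2))
  + 6 * Lf (ind (E \ Thr n)) ((ind (sl B 2)) - (ind (sl B 1))) ((ind (sl C 1)) - (ind (sl C 0)))
  + 6 * Lf (ind (E \ Thr n)) ((ind (sl B 2)) - (ind (sl B 0))) ((ind (sl C 2)) - (ind (sl C 1)))
  + 4 * 2 ^ (n + 1) * Dg (ind (univ : Finset (Pd (n + 1)))) (ind (sl B 0)) ((ind (sl C 1)) - (ind (sl C 0)))
  + 4 * 2 ^ (n + 1) * Dg (ind (univ : Finset (Pd (n + 1)))) ((ind (sl B 1)) - (ind (sl B 0))) (ind (sl C 1))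
  + 6 * Nf ((ind (sl C 2)) - (ind (sl C 1))) (ind (univ : Finset (Pd (n + 1)))) ((ind (sl B 2)) - (ind (sl B 1)))
  + 6 * Lf (ind (univ \ Thr n)) ((ind (sl B 2)) - (ind (sl B 1))) ((ind (sl C 2)) - (ind (sl C 1)))
  + 6 * Nf (ind E) (ind (sl B 0)) ((ind (sl C 2)) - (ind (sl C 0)))
  + 6 * Nf (ind E) ((ind (sl B 2)) - (ind (sl B 0))) (ind (sl C 2))
  + 6 * (Nf ((ind (sl B 1)) - (ind (sl B 0))) (ind (Thr n)) (ind (sl C 1)) - Lf (ind (Thr n)) ((ind (sl B 1)) - (ind (sl B 0))) (ind (sl C 1)))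
  + 6 * (Nf ((ind (sl C 1)) - (ind (sl C 0))) (ind (Thr n)) (ind (sl B 1)) - Lf (ind (Thr n)) (ind (sl B 1)) ((ind (sl C 1)) - (ind (sl C 0))))
  + 6 * (Nf ((ind (sl B 2)) - (ind (sl B 0))) (ind E) (ind (sl C 2)) - Lf (ind E) ((ind (sl B 2)) - (ind (sl B 0))) (ind (sl C 2)))
  + 6 * (Nf ((ind (sl C 2)) - (ind (sl C 0))) (ind E) (ind (sl B 2)) - Lf (ind E) (ind (sl B 2)) ((ind (sl C 2)) - (ind (sl C 0))))
  + 6 * (Nf (ind (E \ Thr n)) (ind (sl B 2)) (ind (sl C 2)) - Lf (ind (E \ Thr n)) (ind (sl B 2)) (ind (sl C 2)))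
  + 6 * (Nf (ind (univ \ E)) (ind (sl B 1)) (ind (sl C 1)) - Lf (ind (univ \ E)) (ind (sl B 1)) (ind (sl C 1)))
  + 2 * (2 ^ (n + 1) * Dg (ind (Thr n)) (ind (sl B 0)) (ind (sl C 0)) - Nf (ind (Thr n)) (ind (sl B 0)) (ind (sl C 0)))
  + 1 * (2 ^ (n + 1) * Dg (ind (Thr n)) (ind (sl B 1)) (ind (sl C 1)) - Nf (ind (Thr n)) (ind (sl B 1)) (ind (sl C 1)))

set_option maxHeartbeats 4000000 in
/-- **THE THRESHOLD-MIDDLE IDENTITY** (every `n`, all finsets `E ⊇ Θ`, `B`, `C`):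
`6·sStarD (Θ×{1} ∪ E×{2}) B C = 12·sStarD E B₂ C₂ + 9·sStarD Θ B₁ C₁ + remMid E B C`. [this work] -/
theorem sStarD_thrMid_eq {E : Finset (Pd (n + 1))} (hTE : Thr n ⊆ E) (B C : Finset (Pd (n + 2))) :
    6 * sStarD (thrMid E) B C = 12 * sStarD E (sl B 2) (sl C 2) + 9 * sStarD (Thr n) (sl B 1) (sl C 1) + remMid E B C := by
  have ss : ∀ f : Pd (n + 2) → ℤ, ∑ x, f x = ∑ i : Fin 3, ∑ p : Pd (n + 1), f (Fin.snoc p i) := fun f => sum_snoc f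
  rw [sStarD_eq_sum_ind]
  simp only [ss, Fin.sum_univ_three, ind_sl, sl_thrMid_zero, sl_thrMid_one, sl_thrMid_two hTE, ind_empty_eq, zero_mul,
    Finset.sum_const_zero, zero_add, Finset.sum_add_distrib]
  rw [block_eq_atoms, block_eq_atoms, block_eq_atoms, block_eq_atoms, block_eq_atoms, block_eq_atoms, block_eq_atoms, block_eq_atoms,
    block_eq_atoms, block_eq_atoms, block_eq_atoms, block_eq_atoms, block_eq_atoms, block_eq_atoms, block_eq_atoms, block_eq_atoms,
    block_eq_atoms, block_eq_atoms]
  obtain ⟨h0, h1, h2, h3, h4, h5, h6, h7, h8, h9, h10, h11, h12, h13, h14, h15, h16, h17, h18, h19, h20, h21, h22, h23, h24, h25, h26, h27, h28, h29, h30, h31, h32, h33, h34, h35, h36, h37, h38, h39, h40, h41, h42, h43, h44, h45, h46, h47, h48, h49, h50, h51, h52, h53, h54, h55, h56, h57, h58, h59⟩ := c_vals_liftTwo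
  simp only [h0, h1, h2, h3, h4, h5, h6, h7, h8, h9, h10, h11, h12, h13, h14, h15, h16, h17, h18, h19, h20, h21, h22, h23, h24, h25, h26, h27, h28, h29, h30, h31, h32, h33, h34, h35, h36, h37, h38, h39, h40, h41, h42, h43, h44, h45, h46, h47, h48, h49, h50, h51, h52, h53, h54, h55, h56, h57, h58, h59]
  rw [sStarD_counting_atoms, sStarD_counting_atoms]
  simp (maxSteps := 20000000) only [remMid, ind_sdiff_fun hTE, ind_univ_sdiff, Dg_sub₂, Dg_sub₃, Nf_sub₁, Nf_sub₂, Nf_sub₃, Lf_sub₁, Lf_sub₂, Lf_sub₃]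
  simp (maxSteps := 20000000) only [Dg_snoc3, Nf_snoc6, Lf_snoc6]
  simp (maxSteps := 20000000) only [fsl_ind, sl_one_of_Thr_subset hTE, sl_two_of_Thr_subset hTE, Thr, sl_liftTwo_zero, sl_liftTwo_one, sl_liftTwo_two, sl_univ_eq]
  simp (maxSteps := 20000000) only [ind_empty_fun, Dg_zero₁, Nf_zero₁, Nf_zero₂, Lf_zero₁, sub_zero, zero_sub,
    zero_mul, add_zero, zero_add]
  simp (maxSteps := 20000000) only [Nf_univ₁, Nf_univ₂]
  simp (maxSteps := 20000000) only [Lf_univ_comm (ind (sl (sl C 0) 0)) (ind (sl (sl B 1) 1)), Lf_univ_comm (ind (sl (sl C 0) 0)) (ind (sl (sl B 1) 2)), Lf_univ_comm (ind (sl (sl C 0) 0)) (ind (sl (sl B 2) 1)), Lf_univ_comm (ind (sl (sl C 0) 0)) (ind (sl (sl B 2) 2)), Lf_univ_comm (ind (sl (sl C 0) 1)) (ind (sl (sl B 1) 2)), Lf_univ_comm (ind (sl (sl C 0) 1)) (ind (sl (sl B 2) 2)), Lf_univ_comm (ind (sl (sl C 0) 2)) (ind (sl (sl B 1) 1)), Lf_univ_comm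 (ind (sl (sl C 0) 2)) (ind (sl (sl B 2) 1)), Lf_univ_comm (ind (sl (sl C 1) 0)) (ind (sl (sl B 1) 1)), Lf_univ_comm (ind (sl (sl C 1) 0)) (ind (sl (sl B 1) 2)), Lf_univ_comm (ind (sl (sl C 1) 0)) (ind (sl (sl B 2) 1)), Lf_univ_comm (ind (sl (sl C 1) 0)) (ind (sl (sl B 2) 2)), Lf_univ_comm (ind (sl (sl C 1) 1)) (ind (sl (sl B 1) 0)), Lf_univ_comm (ind (sl (sl C 1) 1)) (ind (sl (sl B 1) 2)), Lf_univ_comm (ind (sl (sl C 1) 1)) (ind (sl (sl B 2) 0)), Lf_univ_comm (ind (sl (sl C 1) 1)) (ind (sl (sl B 2) 2)), Lf_univ_comm (ind (sl (sl C 1) 2)) (ind (sl (sl B 1) 0)), Lf_univ_comm (ind (sl (sl C 1) 2)) (ind (sl (sl B 1) 1)), Lf_univ_comm (ind (sl (sl C 1) 2)) (ind (sl (sl B 2) 0)), Lf_univ_comm (ind (sl (sl C 1) 2)) (ind (sl (sl B 2) 1)), Lf_univ_comm (ind (sl (sl C 2) 0)) (ind (sl (sl B 1) 1)), Lf_univ_comm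 (ind (sl (sl C 2) 0)) (ind (sl (sl B 1) 2)), Lf_univ_comm (ind (sl (sl C 2) 0)) (ind (sl (sl B 2) 1)), Lf_univ_comm (ind (sl (sl C 2) 0)) (ind (sl (sl B 2) 2)), Lf_univ_comm (ind (sl (sl C 2) 1)) (ind (sl (sl B 1) 0)), Lf_univ_comm (ind (sl (sl C 2) 1)) (ind (sl (sl B 1) 2)), Lf_univ_comm (ind (sl (sl C 2) 1)) (ind (sl (sl B 2) 0)), Lf_univ_comm (ind (sl (sl C 2) 1)) (ind (sl (sl B 2) 2)), Lf_univ_comm (ind (sl (sl C 2) 2)) (ind (sl (sl B 1) 0)), Lf_univ_comm (ind (sl (sl C 2) 2)) (ind (sl (sl B 1) 1)), Lf_univ_comm (ind (sl (sl C 2) 2)) (ind (sl (sl B 2) 0)), Lf_univ_comm (ind (sl (sl C 2) 2)) (ind (sl (sl B 2) 1))]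
  ring

/-- **The threshold-middle remainder is in the pair cone** (for an up-set `E`). [this work] -/
theorem remMid_inPairCone {E : Finset (Pd (n + 1))} (hE : IsUpperSet (E : Set (Pd (n + 1)))) :
    InPairCone (n + 2) (fun B C => (remMid E B C : ℝ)) := by
  have h01 : (0 : Fin 3) ≤ 1 := by decide
  have h12 : (1 : Fin 3) ≤ 2 := by decide
  have h02 : (0 : Fin 3) ≤ 2 := by decide
  have e0 := ((inPairCone_VcP (E \ Thr n) h12 2)).smul (by norm_num : (0:ℝ) ≤ 6)
  have e1 := ((inPairCone_VbP (E \ Thr n) h12 2)).smul (by norm_num : (0:ℝ) ≤ 6)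
  have e2 := ((inPairCone_LfVV (E \ Thr n) h12 h01)).smul (by norm_num : (0:ℝ) ≤ 6)
  have e3 := ((inPairCone_LfVV (E \ Thr n) h02 h12)).smul (by norm_num : (0:ℝ) ≤ 6)
  have e4 := (((inPairCone_DgPV (univ : Finset (Pd (n + 1))) 0 h01).smul (by positivity : (0:ℝ) ≤ 2 ^ (n + 1)))).smul (by norm_num : (0:ℝ) ≤ 4)
  have e5 := (((inPairCone_DgVP (univ : Finset (Pd (n + 1))) h01 1).smul (by positivity : (0:ℝ) ≤ 2 ^ (n + 1)))).smul (by norm_num : (0:ℝ) ≤ 4)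
  have e6 := ((inPairCone_VVc (univ : Finset (Pd (n + 1))) h12 h12)).smul (by norm_num : (0:ℝ) ≤ 6)
  have e7 := ((inPairCone_LfVV (univ \ Thr n) h12 h12)).smul (by norm_num : (0:ℝ) ≤ 6)
  have e8 := ((inPairCone_PV E 0 h02)).smul (by norm_num : (0:ℝ) ≤ 6)
  have e9 := ((inPairCone_VP E h02 2)).smul (by norm_num : (0:ℝ) ≤ 6)
  have e10 := ((inPairCone_Kb (isUpperSet_Thr n) h01 1)).smul (by norm_num : (0:ℝ) ≤ 6)
  have e11 := ((inPairCone_Kc (isUpperSet_Thr n) h01 1)).smul (by norm_num : (0:ℝ) ≤ 6)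
  have e12 := ((inPairCone_Kb hE h02 2)).smul (by norm_num : (0:ℝ) ≤ 6)
  have e13 := ((inPairCone_Kc hE h02 2)).smul (by norm_num : (0:ℝ) ≤ 6)
  have e14 := ((inPairCone_HF (E \ Thr n) 2 2)).smul (by norm_num : (0:ℝ) ≤ 6)
  have e15 := ((inPairCone_HF (univ \ E) 1 1)).smul (by norm_num : (0:ℝ) ≤ 6)
  have e16 := ((inPairCone_KD_thr (n := n) 0)).smul (by norm_num : (0:ℝ) ≤ 2)
  have e17 := ((inPairCone_KD_thr (n := n) 1)).smul (by norm_num : (0:ℝ) ≤ 1)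
  refine ((((((((((((((((((e0.add e1).add e2).add e3).add e4).add e5).add e6).add e7).add e8).add e9).add e10).add e11).add e12).add e13).add e14).add e15).add e16).add e17)).congr fun B C _ _ => ?_
  simp only [remMid]
  push_cast
  ring

/-- **THE THRESHOLD-MIDDLE LIFT at the format level**: if the up-set `E ⊇ Θ` of `[3]^{n+1}` has a pinned certificate, so does
`Θ × {1} ∪ E × {2} ⊆ [3]^{n+2}` (the threshold `Θ` itself is pinned-good by `pinnedGood_threshold_one`). [this work] -/
theorem PinnedGood.thrMid {E : Finset (Pd (n + 1))} (hE : IsUpperSet (E : Set (Pd (n + 1)))) (hTE : Thr n ⊆ E) (h : PinnedGood (n + 1) E) :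
    PinnedGood (n + 2) (thrMid E) := by
  have hT : PinnedGood (n + 1) (Thr n) := pinnedGood_threshold_one n
  have c6 : (0:ℝ) ≤ 1 / 6 := by norm_num
  refine (((((h.slices 2 2).smul (by norm_num : (0:ℝ) ≤ 12)).add ((hT.slices 1 1).smul (by norm_num : (0:ℝ) ≤ 9))).add
    (remMid_inPairCone hE)).smul c6).congr fun B C _ _ => ?_
  have e := sStarD_thrMid_eq hTE B C
  have e' : (sStarD (SahiSlot.thrMid E) B C : ℝ) =
      (1 / 6) * (12 * (sStarD E (sl B 2) (sl C 2) : ℝ) + 9 * (sStarD (Thr n) (sl B 1) (sl C 1) : ℝ) + (remMid E B C : ℝ)) := by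
    have := congrArg (fun z : ℤ => (z : ℝ)) e
    push_cast at this
    linarith
  rw [e']

/-- VALUE-LEVEL corollary. [this work] -/
theorem sStarD_thrMid_nonneg {E : Finset (Pd (n + 1))} (hE : IsUpperSet (E : Set (Pd (n + 1)))) (hTE : Thr n ⊆ E)
    (h : PinnedGood (n + 1) E) (B C : Finset (Pd (n + 2))) (hB : IsUpperSet (B : Set (Pd (n + 2)))) (hC : IsUpperSet (C : Set (Pd (n + 2)))) :
    0 ≤ sStarD (thrMid E) B C :=
  (h.thrMid hE hTE).sStarD_nonneg B C hB hC

end SahiSlot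

end Summit.CriticalPhenomena.PercolationContinuityZ3.Theorems
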